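import Literature.AlgebraicGeometry.Modules.CechTheta
import Literature.AlgebraicGeometry.Motives.ChernClassesProofs
import HarnessLib

/-!
# The `Ext¹`-class of a locally split short exact sequence is the Čech class of the difference of splittings

Let `X` be a scheme, `𝓤 = (U_a)_{a ∈ ι}` an open cover, and `S : 0 → N →f P →g E → 0` a short exact
sequence of `𝒪_X`-modules which SPLITS over each `U_a`: splittings
`σ_a = (r_a : P|_{U_a} → N|_{U_a}, s_a : E|_{U_a} → P|_{U_a})` of the restricted sequence
(Mathlib `ShortComplex.Splitting`; e.g. `E` and `N` finite locally free and `P|_{U_a}` framed, or any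
sequence of vector bundles over affine opens). The **difference cocycle** of the splittings is the
Čech `1`-cochain of local homomorphisms (`Cech.LocalFamily`, `Modules/CechTheta.lean`)

  `δ(σ)_{ab} = s_a ≫ r_b : E|_{U_a ∩ U_b} → N|_{U_a ∩ U_b}`

(`splittingDifference`; `f ∘ (s_a r_b) = s_a - s_b` and `(s_a r_b) ∘ g = r_b - r_a`, the two usual
descriptions "difference of the sections" / "difference of the retractions"). It is a cocycle
(`dFamily_splittingDifference`), and ITS ČECH CLASS IS THE YONEDA CLASS OF THE EXTENSION:

  `Cech.classOf a δ(σ) = hS.extClass ∈ Ext¹(E, N)`  (`classOf_splittingDifference`),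

for any exact augmentation `a` of `Č•(𝓤, N)` by `Cech.augment` (e.g. `Cech.exactAugmentation` of a
cover). Proof: the retractions define `ρ♯ : P → Č⁰(𝓤, N)`, `p ↦ (r_a p)_a`, with `f ≫ ρ♯ = ε` and
`ρ♯ ≫ d = g ≫ δ(σ)♯`, i.e. a morphism of short exact sequences from `S` to the first piece
`0 → Z⁰ → Č⁰ → Z¹ → 0` of the resolution; conclude by the naturality of `extClass` (Mathlib
`ShortExact.extClass_naturality`) and `θ(ω) = [ω̄] ∘ [T₀] ∘ [Z⁰ ≅ N]`. This is the classical
computation of the connecting homomorphism `H⁰(E-valued) → H¹` by Čech cochains (Hartshorne III.4,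
proof of Thm. 4.5; Godement II.5.10), in the form needed to identify the ATIYAH CLASS — the class of
the jet sequence, split by every frame — with the Čech cocycle `{dT_{ab} T_{ab}⁻¹}` (Atiyah 1957 §4,
Prop. 12). Everything is proved; no named facts.

## References

* R. Hartshorne, *Algebraic Geometry*, GTM 52 (1977), III.4, Lemma 4.4 and Thm. 4.5. [Hartshorne1977]
* R. Godement, *Topologie algébrique et théorie des faisceaux* (1958), II.5.10.
* M. F. Atiyah, *Complex analytic connections in fibre bundles*, Trans. AMS 85 (1957), §4. [Atiyah1957]
-/

noncomputable section

universe u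

open CategoryTheory CategoryTheory.Abelian AlgebraicGeometry Opposite TopologicalSpace Limits
  HomologicalComplex

namespace Literature.AlgebraicGeometry.Modules

namespace Cech

open Literature.AlgebraicGeometry.Motives Literature.Algebra.Homology

variable {X : Scheme.{u}} {ι : Type u} {U : ι → X.Opens} {S : ShortComplex X.Modules}

/-- **Local splittings** of a short complex of `𝒪_X`-modules over a family of opens: a splitting of
`S|_{U_a}` for every `a`. [folklore] -/
abbrev LocalSplittings (U : ι → X.Opens) (S : ShortComplex X.Modules) :=
  ∀ a : ι, (S.map (Scheme.Modules.overFunctor (U a))).Splitting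

variable (σ : LocalSplittings U S)

/-! ### The splitting data on the canonical restricted types -/

/-- The retraction `r_a : P|_{U_a} → N|_{U_a}` (retyped on `S.X₂.over (U a) ⟶ S.X₁.over (U a)`).
[folklore] -/
def ret (a : ι) : S.X₂.over (U a) ⟶ S.X₁.over (U a) := (σ a).r

/-- The section `s_a : E|_{U_a} → P|_{U_a}` (retyped on `S.X₃.over (U a) ⟶ S.X₂.over (U a)`).
[folklore] -/
def sec (a : ι) : S.X₃.over (U a) ⟶ S.X₂.over (U a) := (σ a).s

/-- `f| ≫ r_a = 𝟙`. [folklore] -/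
lemma f_ret (a : ι) : (SheafOfModules.overFunctor _ (U a)).map S.f ≫ ret σ a = 𝟙 (S.X₁.over (U a)) :=
  (σ a).f_r

/-- `s_a ≫ g| = 𝟙`. [folklore] -/
lemma sec_g (a : ι) : sec σ a ≫ (SheafOfModules.overFunctor _ (U a)).map S.g = 𝟙 (S.X₃.over (U a)) :=
  (σ a).s_g

/-- `r_a ≫ f| + g| ≫ s_a = 𝟙`. [folklore] -/
lemma ret_f_add_g_sec (a : ι) :
    ret σ a ≫ (SheafOfModules.overFunctor _ (U a)).map S.f +
      (SheafOfModules.overFunctor _ (U a)).map S.g ≫ sec σ a = 𝟙 (S.X₂.over (U a)) :=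
  (σ a).id

/-! ### The retraction family and the difference cocycle -/

/-- The `0`-cochain of retractions `ρ_a = r_a : P|_{U_a} → N|_{U_a}` (restricted to the face
`U_{(a)} = ⨅ U_a`). [folklore] -/
def retractionFamily : LocalFamily U 0 S.X₂ S.X₁ := fun β =>
  restrictHom (homOfLE (face_le U β 0)) (ret σ (β 0))

/-- **The difference cocycle of local splittings**: `δ(σ)_{ab} = s_a ≫ r_b` over `U_a ∩ U_b`.
[cite: Hartshorne1977, III.4 (proof of Thm. 4.5)] -/
def splittingDifference : LocalFamily U 1 S.X₃ S.X₁ := fun β =>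
  restrictHom (homOfLE (face_le U β 0)) (sec σ (β 0)) ≫ restrictHom (homOfLE (face_le U β 1)) (ret σ (β 1))

/-- Values of the retraction family. [folklore] -/
lemma appLE_retractionFamily (β : Fin 1 → ι) {W : X.Opens} (k : W ⟶ face U β) (p : Γ(S.X₂, W)) :
    appLE (retractionFamily σ β) k p = appLE (ret σ (β 0)) (k ≫ homOfLE (face_le U β 0)) p := rfl

/-- Values of the difference cocycle: `δ_{ab}(x) = r_b(s_a(x))`. [folklore] -/
lemma appLE_splittingDifference (β : Fin 2 → ι) {W : X.Opens} (k : W ⟶ face U β) (x : Γ(S.X₃, W)) :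
    appLE (splittingDifference σ β) k x =
      appLE (ret σ (β 1)) (k ≫ homOfLE (face_le U β 1)) (appLE (sec σ (β 0)) (k ≫ homOfLE (face_le U β 0)) x) :=
  rfl

/-- `r_a (f x) = x` on sections. [folklore] -/
lemma appLE_r_f_app (a : ι) {W : X.Opens} (k : W ⟶ U a) (x : Γ(S.X₁, W)) :
    appLE (ret σ a) k (S.f.app W x) = x := by
  have h' := congrArg (fun φ => appLE φ k x) (f_ret σ a)
  simp only [appLE_comp, appLE_over_map, appLE_id] at h'
  exact h'

/-- `g (s_a x) = x` on sections. [folklore] -/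
lemma g_app_appLE_s (a : ι) {W : X.Opens} (k : W ⟶ U a) (x : Γ(S.X₃, W)) :
    S.g.app W (appLE (sec σ a) k x) = x := by
  have h' := congrArg (fun φ => appLE φ k x) (sec_g σ a)
  simp only [appLE_comp, appLE_over_map, appLE_id] at h'
  exact h'

/-- `f (r_a p) + s_a (g p) = p` on sections. [folklore] -/
lemma f_app_appLE_r_add (a : ι) {W : X.Opens} (k : W ⟶ U a) (p : Γ(S.X₂, W)) :
    S.f.app W (appLE (ret σ a) k p) + appLE (sec σ a) k (S.g.app W p) = p := by
  have h' := congrArg (fun φ => appLE φ k p) (ret_f_add_g_sec σ a)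
  simp only [appLE_add, appLE_comp, appLE_over_map, appLE_id] at h'
  exact h'

/-- `r_b p - r_a p = r_b (s_a (g p))` on sections over `W ≤ U_a ∩ U_b` ("difference of the
retractions = difference cocycle after `g`"). [folklore] -/
lemma appLE_r_sub_appLE_r (a b : ι) {W : X.Opens} (ka : W ⟶ U a) (kb : W ⟶ U b) (p : Γ(S.X₂, W)) :
    appLE (ret σ b) kb p - appLE (ret σ a) ka p =
      appLE (ret σ b) kb (appLE (sec σ a) ka (S.g.app W p)) := by
  have h := congrArg (appLE (ret σ b) kb) (f_app_appLE_r_add σ a ka p).symm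
  rw [appLE_add_right, appLE_r_f_app] at h
  rw [h, add_sub_cancel_left]

/-- **The difference cocycle is a cocycle.** [cite: Hartshorne1977, III Lemma 4.4] -/
theorem dFamily_splittingDifference : dFamily (splittingDifference σ) = 0 := by
  funext β
  apply hom_ext_of_appLE
  intro W k x
  rw [Pi.zero_apply, appLE_zero, dFamily, appLE_sum, Fin.sum_univ_three, appLE_zsmul, appLE_zsmul,
    appLE_zsmul, appLE_restrictHom, appLE_restrictHom, appLE_restrictHom]
  simp only [Fin.val_zero, pow_zero, one_smul, Fin.val_one, pow_one, neg_one_zsmul, Fin.val_two,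
    neg_one_sq, appLE_splittingDifference]
  -- notation: a = β 0, b = β 1, c = β 2; the faces are (b,c), (a,c), (a,b):
  -- `r_c s_b x - r_c s_a x + r_b s_a x = 0`
  set ka : W ⟶ U (β 0) := k ≫ homOfLE (face_le U β 0)
  set kb : W ⟶ U (β 1) := k ≫ homOfLE (face_le U β 1)
  set kc : W ⟶ U (β 2) := k ≫ homOfLE (face_le U β 2)
  have e1 : appLE (ret σ ((β ∘ Fin.succAbove 0) 1))
      ((k ≫ homOfLE (face_le_face_comp U β (Fin.succAbove 0))) ≫ homOfLE (face_le U _ 1))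
      (appLE (sec σ ((β ∘ Fin.succAbove 0) 0))
        ((k ≫ homOfLE (face_le_face_comp U β (Fin.succAbove 0))) ≫ homOfLE (face_le U _ 0)) x) =
      appLE (ret σ (β 2)) kc (appLE (sec σ (β 1)) kb x) := by
    rw [appLE_congr_hom (sec σ (β 1)) _ kb]; exact appLE_congr_hom _ _ _ _
  have e2 : appLE (ret σ ((β ∘ Fin.succAbove 1) 1))
      ((k ≫ homOfLE (face_le_face_comp U β (Fin.succAbove 1))) ≫ homOfLE (face_le U _ 1))
      (appLE (sec σ ((β ∘ Fin.succAbove 1) 0))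
        ((k ≫ homOfLE (face_le_face_comp U β (Fin.succAbove 1))) ≫ homOfLE (face_le U _ 0)) x) =
      appLE (ret σ (β 2)) kc (appLE (sec σ (β 0)) ka x) := by
    rw [appLE_congr_hom (sec σ (β 0)) _ ka]; exact appLE_congr_hom _ _ _ _
  have e3 : appLE (ret σ ((β ∘ Fin.succAbove 2) 1))
      ((k ≫ homOfLE (face_le_face_comp U β (Fin.succAbove 2))) ≫ homOfLE (face_le U _ 1))
      (appLE (sec σ ((β ∘ Fin.succAbove 2) 0))
        ((k ≫ homOfLE (face_le_face_comp U β (Fin.succAbove 2))) ≫ homOfLE (face_le U _ 0)) x) =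
      appLE (ret σ (β 1)) kb (appLE (sec σ (β 0)) ka x) := by
    rw [appLE_congr_hom (sec σ (β 0)) _ ka]; exact appLE_congr_hom _ _ _ _
  rw [e1, e2, e3]
  -- with p := s_a x (so g p = x): r_c s_b x = r_c p - r_b p
  have key := appLE_r_sub_appLE_r σ (β 1) (β 2) kb kc (appLE (sec σ (β 0)) ka x)
  rw [g_app_appLE_s] at key
  rw [← key]
  abel

/-! ### The morphism of short exact sequences `S → (Z⁰ → Č⁰ → Z¹)` -/

/-- **`f ≫ ρ♯ = ε`**: `r_a (f x) = x|_{U_a}`. [folklore] -/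
theorem f_comp_familyHom_retractionFamily :
    S.f ≫ familyHom (retractionFamily σ) = augment U S.X₁ := by
  refine hom_ext_to fun W x β => ?_
  rw [Scheme.Modules.Hom.comp_app, CategoryTheory.comp_apply, familyHom_app_apply,
    augment_app_apply, appLE_retractionFamily, ← Scheme.Modules.Hom.app_map_apply, appLE_r_f_app]

/-- **`ρ♯ ≫ d = g ≫ δ(σ)♯`**: `r_b p - r_a p = r_b s_a (g p)`. [folklore] -/
theorem familyHom_retractionFamily_comp_d :
    familyHom (retractionFamily σ) ≫ d U S.X₁ 0 = S.g ≫ familyHom (splittingDifference σ) := by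
  refine hom_ext_to fun W p β => ?_
  rw [Scheme.Modules.Hom.comp_app, CategoryTheory.comp_apply, d_app_eq_dSections,
    dSections_zero_apply, familyHom_app_apply, familyHom_app_apply, Scheme.Modules.Hom.comp_app,
    CategoryTheory.comp_apply, familyHom_app_apply, appLE_retractionFamily, appLE_retractionFamily,
    appLE_splittingDifference]
  set V := W ⊓ face U β
  set ka : V ⟶ U (β 0) := homOfLE (inf_le_right.trans (face_le U β 0))
  set kb : V ⟶ U (β 1) := homOfLE (inf_le_right.trans (face_le U β 1))
  have e1 : res S.X₁ (inf_le_inf_left W (face_le_face_comp U β (Fin.succAbove 0)))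
      (appLE (ret σ ((β ∘ Fin.succAbove 0) 0))
        (homOfLE inf_le_right ≫ homOfLE (face_le U (β ∘ Fin.succAbove 0) 0))
        (res S.X₂ inf_le_left p)) = appLE (ret σ (β 1)) kb (res S.X₂ inf_le_left p) := by
    change S.X₁.presheaf.map (homOfLE _).op (appLE _ _ _) = _
    rw [← appLE_map, presheaf_map_map]
    exact appLE_congr_hom _ _ _ _
  have e2 : res S.X₁ (inf_le_inf_left W (face_le_face_comp U β (Fin.succAbove 1)))
      (appLE (ret σ ((β ∘ Fin.succAbove 1) 0))
        (homOfLE inf_le_right ≫ homOfLE (face_le U (β ∘ Fin.succAbove 1) 0))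
        (res S.X₂ inf_le_left p)) = appLE (ret σ (β 0)) ka (res S.X₂ inf_le_left p) := by
    change S.X₁.presheaf.map (homOfLE _).op (appLE _ _ _) = _
    rw [← appLE_map, presheaf_map_map]
    exact appLE_congr_hom _ _ _ _
  rw [e1, e2, appLE_r_sub_appLE_r σ (β 0) (β 1) ka kb, Scheme.Modules.Hom.app_map_apply]
  rfl

variable [HasExt.{u + 1} X.Modules] (hS : S.ShortExact)
  (a : ExactAugmentation (complex U S.X₁) S.X₁) (ha : a.ε = augment U S.X₁)

/-- `ρ♯` typed as a morphism into the degree-`0` term of the Čech COMPLEX. [folklore] -/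
abbrev rhoX : S.X₂ ⟶ (complex U S.X₁).X 0 := familyHom (retractionFamily σ)

/-- `δ(σ)♯` typed as a morphism into the degree-`1` term of the Čech COMPLEX. [folklore] -/
abbrev deltaX : S.X₃ ⟶ (complex U S.X₁).X 1 := familyHom (splittingDifference σ)

omit [HasExt.{u + 1} X.Modules] in
/-- `δ(σ)♯` is a cocycle of the Čech complex. [folklore] -/
lemma deltaX_d : deltaX σ ≫ (complex U S.X₁).d 1 2 = 0 :=
  familyHom_comp_d_eq_zero _ (dFamily_splittingDifference σ)

/-- The morphism of short complexes from `S` to the first piece `T₀ : Z⁰ → Č⁰ → Z¹` of the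
augmented Čech complex of `N`, given by the retractions and the difference cocycle. [folklore] -/
def toPieceZero : S ⟶ ExactAugmentation.T (complex U S.X₁) 0 where
  τ₁ := a.isoCyclesZero.hom
  τ₂ := rhoX σ
  τ₃ := ExactAugmentation.bar (deltaX σ) (deltaX_d σ)
  comm₁₂ := by
    change a.isoCyclesZero.hom ≫ (complex U S.X₁).iCycles 0 = S.f ≫ rhoX σ
    rw [a.isoCyclesZero_hom_iCycles, ha]
    exact (f_comp_familyHom_retractionFamily σ).symm
  comm₂₃ := by
    change rhoX σ ≫ (complex U S.X₁).toCycles 0 (0 + 1) = S.g ≫ ExactAugmentation.bar (deltaX σ) (deltaX_d σ)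
    rw [← cancel_mono ((complex U S.X₁).iCycles (0 + 1)), Category.assoc, Category.assoc,
      HomologicalComplex.toCycles_i, HomologicalComplex.liftCycles_i]
    exact familyHom_retractionFamily_comp_d σ

include ha in
/-- **The `Ext¹`-class of a locally split short exact sequence is the Čech class of the difference
cocycle of the splittings**: `[δ(σ)] = [S] ∈ Ext¹(E, N)`.
[cite: Hartshorne1977, III.4 (Lemma 4.4, Thm. 4.5)] -/
theorem classOf_splittingDifference :
    classOf a (splittingDifference σ) (dFamily_splittingDifference σ) = hS.extClass := by
  rw [classOf_def, ExactAugmentation.theta_def, ExactAugmentation.kappa_succ,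
    ExactAugmentation.kappa_zero]
  have hnat := ShortComplex.ShortExact.extClass_naturality hS (a.shortExact_T 0) (toPieceZero σ a ha)
  -- `[τ₃] ∘ [T₀] = [S] ∘ [τ₁]`
  change (Ext.mk₀ (toPieceZero σ a ha).τ₃).comp
      ((a.shortExact_T 0).extClass.comp (Ext.mk₀ a.isoCyclesZero.inv) (by omega)) (zero_add _) = _
  rw [← Ext.comp_assoc _ _ _ (zero_add 1) (by omega) (by omega), ← hnat,
    Ext.comp_assoc_of_third_deg_zero, Ext.mk₀_comp_mk₀]
  change hS.extClass.comp (Ext.mk₀ (a.isoCyclesZero.hom ≫ a.isoCyclesZero.inv)) (add_zero 1) = _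
  rw [Iso.hom_inv_id, Ext.comp_mk₀_id]

/-- The same, for the Čech resolution of an open cover. [cite: Hartshorne1977, III.4 (Thm. 4.5)] -/
theorem classOf_splittingDifference_exactAugmentation (hU : iSup U = ⊤) :
    classOf (exactAugmentation U S.X₁ hU) (splittingDifference σ) (dFamily_splittingDifference σ) =
      hS.extClass :=
  classOf_splittingDifference σ hS _ (exactAugmentation_ε U S.X₁ hU)

omit [HasExt.{u + 1} X.Modules] in
/-- Local splittings exist over any open on which a section of `g` is given (five lemma,
Mathlib `Splitting.ofExactOfSection`), e.g. from a frame of a finite locally free `E|_{U_a}` by lifting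
basis sections. [folklore] -/
def localSplittingOfSection (hS : S.ShortExact) (W : X.Opens) (s : S.X₃.over W ⟶ S.X₂.over W)
    (hs : s ≫ (S.map (Scheme.Modules.overFunctor W)).g = 𝟙 _) :
    (S.map (Scheme.Modules.overFunctor W)).Splitting :=
  haveI := (Scheme.Modules.shortExact_map_overFunctor hS W).mono_f
  ShortComplex.Splitting.ofExactOfSection _ (Scheme.Modules.shortExact_map_overFunctor hS W).exact
    s hs inferInstance

end Cech

end Literature.AlgebraicGeometry.Modules

end
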